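import Summits.Ventures.HSemireg.WedgeHankelRecurrenceHurwitzLowDeterminants

/-!
# Venture HSemireg — KHARITONOV'S THEOREM IN DEGREES 2 AND 3: an INTERVAL family of real quadratics ∕ cubics `p = Σ c_k X^k`, `l_k ≤ c_k ≤ u_k` (degree fixed: `0 < l_n`), is Hurwitz-stable
# for EVERY member iff finitely many VERTEX inequalities hold — degree 2: `0 < l_0 ∧ 0 < l_1`; degree 3: `0 < l_0 ∧ 0 < l_2 ∧ u_0 u_3 < l_1 l_2`, i.e. iff `0 < l_0` and the ONE vertex
# polynomial `u_0 + l_1 X + l_2 X² + u_3 X³` (one of Kharitonov's four) is Hurwitz (Anderson–Jury–Mansour: for `n = 3` a single Kharitonov polynomial suffices) — from the explicit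
# low-degree Routh–Hurwitz criteria of N216

HONEST FRAMING. Part of the Lean index of the computation cell `pub-hsemireg` (seat p10 gen 39, Sunday typer «UNIFORM-IN-n»).  Elementary real inequalities on top of N216; no variety, no cohomology
theory, no sheaf, no Ext group and no semiregularity map is constructed here; nothing here says that HC / HC_CM / HC_AV holds; no Literature fact (unproved `Prop`) is declared or used.  Custodian
versions as in `WedgeHankelSiegelIdeal` (1/3).
SOURCES (cited).  V. L. Kharitonov, *Asymptotic stability of an equilibrium position of a family of systems of linear differential equations*, Differ. Uravn. 14 (1978) 2086–2088; B. D. O. Anderson,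
E. I. Jury, M. Mansour, *On robust Hurwitz polynomials*, IEEE Trans. Automat. Control 32 (1987) 909–913 (for `n = 3, 4, 5` one, two, three of the four Kharitonov polynomials suffice);
Gantmacher II Ch. XV §6 (the cubic criterion `a_1 a_2 > a_0 a_3`); Hairer–Nørsett–Wanner I §I.13.
DEDUP DISCLOSURE (`rg`, 2026-09-02): `Kharitonov` — 0 relevant hits (one unrelated author name in `Literature/Computability/Learning/PAC.lean`); N216 `forall_re_neg_iff_of_natDegree_two ∕ _three` are the
pointwise criteria; no interval ∕ box statement exists.  The 3 names below: 0 hits tree-wide.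

WHAT IS IN THE TREE.  N216: `forall_re_neg_iff_of_natDegree_two`, `forall_re_neg_iff_of_natDegree_three`.  Mathlib: `natDegree_quadratic`, `natDegree_cubic`, `coeff_C_mul_X_pow`.
THIS FILE (namespace `Summit.Ventures.HSemireg.Wedge.HankelOuter` continued; PLAIN over N216; 0 definitions):
* §949 `forall_re_neg_box_iff_of_natDegree_two` (box of quadratics Hurwitz iff `0 < l_0 ∧ 0 < l_1`), **`forall_re_neg_box_iff_of_natDegree_three`** (box of cubics Hurwitz iff
  `0 < l_0 ∧ 0 < l_2 ∧ u_0 u_3 < l_1 l_2`), `forall_re_neg_box_iff_vertex_of_natDegree_three` (… iff `0 < l_0` and the vertex cubic `u_3 X³ + l_2 X² + l_1 X + u_0` is Hurwitz).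
CAVEATS.  Degrees 2 and 3 only (degree ≥ 4 needs two or more vertex polynomials and the general Kharitonov argument via the Hermite–Biehler interlacing, not typed); ascending coefficients
`c_k = p.coeff k`; the box is `∀ k ≤ n, l k ≤ p.coeff k ≤ u k` with `l k ≤ u k`.  Nothing Ext-side.  New names only.
-/

open Polynomial
open scoped Polynomial

namespace Summit.Ventures.HSemireg.Wedge.HankelOuter

/-! ## §949. Interval quadratics and cubics (Kharitonov, `n ≤ 3`) -/

/-- **Interval quadratics**: with `0 < l_2` and `l_k ≤ u_k`, EVERY `p` of degree `2` with `l_k ≤ p.coeff k ≤ u_k` (`k ≤ 2`) is Hurwitz iff `0 < l_0 ∧ 0 < l_1` (test the vertex `u_2 X² + l_1 X + l_0`).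
[Kharitonov 1978, `n = 2`; N216; this file, §949] -/
theorem forall_re_neg_box_iff_of_natDegree_two {l u : ℕ → ℝ} (hl2 : 0 < l 2) (hlu : ∀ k ≤ 2, l k ≤ u k) :
    (∀ p : ℝ[X], p.natDegree = 2 → (∀ k ≤ 2, l k ≤ p.coeff k ∧ p.coeff k ≤ u k) → ∀ z ∈ (p.map (algebraMap ℝ ℂ)).roots, z.re < 0) ↔ 0 < l 0 ∧ 0 < l 1 := by
  have hu2 : 0 < u 2 := hl2.trans_le (hlu 2 le_rfl)
  constructor
  · intro H
    set q : ℝ[X] := C (u 2) * X ^ 2 + C (l 1) * X + C (l 0) with hq_def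
    have hqdeg : q.natDegree = 2 := natDegree_quadratic hu2.ne'
    have hq0 : q.coeff 0 = l 0 := by simp [hq_def]
    have hq1 : q.coeff 1 = l 1 := by simp [hq_def]
    have hq2 : q.coeff 2 = u 2 := by simp [hq_def]
    have hbox : ∀ k ≤ 2, l k ≤ q.coeff k ∧ q.coeff k ≤ u k := by
      intro k hk
      interval_cases k
      · rw [hq0]; exact ⟨le_rfl, hlu 0 (by norm_num)⟩
      · rw [hq1]; exact ⟨le_rfl, hlu 1 (by norm_num)⟩
      · rw [hq2]; exact ⟨hlu 2 le_rfl, le_rfl⟩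
    have h := (forall_re_neg_iff_of_natDegree_two hqdeg (by rw [hq2]; exact hu2)).1 (H q hqdeg hbox)
    rw [hq0, hq1] at h
    exact ⟨h.2, h.1⟩
  · rintro ⟨h0, h1⟩ p hp hbox
    exact (forall_re_neg_iff_of_natDegree_two hp (hl2.trans_le (hbox 2 le_rfl).1)).2 ⟨h1.trans_le (hbox 1 (by norm_num)).1, h0.trans_le (hbox 0 (by norm_num)).1⟩

/-- **KHARITONOV FOR CUBICS**: with `0 < l_3` and `l_k ≤ u_k`, EVERY `p` of degree `3` with `l_k ≤ p.coeff k ≤ u_k` (`k ≤ 3`) is Hurwitz iff `0 < l_0 ∧ 0 < l_2 ∧ u_0 u_3 < l_1 l_2` — the cubic criterion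
`c_2 > 0, c_2 c_1 − c_3 c_0 > 0, c_0 > 0` is monotone in each coefficient, so it is worst at the vertex `(u_0, l_1, l_2, u_3)`. [Kharitonov 1978; Anderson–Jury–Mansour 1987, `n = 3`; N216; this file, §949] -/
theorem forall_re_neg_box_iff_of_natDegree_three {l u : ℕ → ℝ} (hl3 : 0 < l 3) (hlu : ∀ k ≤ 3, l k ≤ u k) :
    (∀ p : ℝ[X], p.natDegree = 3 → (∀ k ≤ 3, l k ≤ p.coeff k ∧ p.coeff k ≤ u k) → ∀ z ∈ (p.map (algebraMap ℝ ℂ)).roots, z.re < 0)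
      ↔ 0 < l 0 ∧ 0 < l 2 ∧ u 0 * u 3 < l 1 * l 2 := by
  have hu3 : 0 < u 3 := hl3.trans_le (hlu 3 le_rfl)
  constructor
  · intro H
    -- the vertex `(c, l 1, l 2, u 3)` for `c ∈ {l 0, u 0}`
    have key : ∀ c : ℝ, l 0 ≤ c → c ≤ u 0 → 0 < l 2 ∧ 0 < l 2 * l 1 - u 3 * c ∧ 0 < c := by
      intro c hlc hcu
      set q : ℝ[X] := C (u 3) * X ^ 3 + C (l 2) * X ^ 2 + C (l 1) * X + C c with hq_def
      have hqdeg : q.natDegree = 3 := natDegree_cubic hu3.ne'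
      have hq0 : q.coeff 0 = c := by simp [hq_def]
      have hq1 : q.coeff 1 = l 1 := by simp [hq_def]
      have hq2 : q.coeff 2 = l 2 := by simp [hq_def]
      have hq3 : q.coeff 3 = u 3 := by simp [hq_def]
      have hbox : ∀ k ≤ 3, l k ≤ q.coeff k ∧ q.coeff k ≤ u k := by
        intro k hk
        interval_cases k
        · rw [hq0]; exact ⟨hlc, hcu⟩
        · rw [hq1]; exact ⟨le_rfl, hlu 1 (by norm_num)⟩
        · rw [hq2]; exact ⟨le_rfl, hlu 2 (by norm_num)⟩
        · rw [hq3]; exact ⟨hlu 3 le_rfl, le_rfl⟩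
      have h := (forall_re_neg_iff_of_natDegree_three hqdeg (by rw [hq3]; exact hu3)).1 (H q hqdeg hbox)
      rwa [hq0, hq1, hq2, hq3] at h
    obtain ⟨h2, h21, hu0⟩ := key (u 0) (hlu 0 (by norm_num)) le_rfl
    obtain ⟨-, -, h0⟩ := key (l 0) le_rfl (hlu 0 (by norm_num))
    exact ⟨h0, h2, by linarith⟩
  · rintro ⟨h0, h2, h12⟩ p hp hbox
    have hu0 : 0 < u 0 := h0.trans_le (hlu 0 (by norm_num))
    have hl1 : 0 < l 1 := pos_of_mul_pos_left ((mul_pos hu0 hu3).trans h12) h2.le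
    have hc0 := hbox 0 (by norm_num)
    have hc1 := hbox 1 (by norm_num)
    have hc2 := hbox 2 (by norm_num)
    have hc3 := hbox 3 le_rfl
    refine (forall_re_neg_iff_of_natDegree_three hp (hl3.trans_le hc3.1)).2 ⟨h2.trans_le hc2.1, ?_, h0.trans_le hc0.1⟩
    have hA : l 2 * l 1 ≤ p.coeff 2 * p.coeff 1 := mul_le_mul hc2.1 hc1.1 hl1.le (h2.le.trans hc2.1)
    have hB : p.coeff 0 * p.coeff 3 ≤ u 0 * u 3 := mul_le_mul hc0.2 hc3.2 (hl3.le.trans hc3.1) hu0.le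
    linarith

/-- **One vertex polynomial suffices for cubics** (Anderson–Jury–Mansour): the box of cubics is Hurwitz iff `0 < l_0` and the single vertex cubic `u_3 X³ + l_2 X² + l_1 X + u_0` is Hurwitz.
[Anderson–Jury–Mansour 1987; this file, §949] -/
theorem forall_re_neg_box_iff_vertex_of_natDegree_three {l u : ℕ → ℝ} (hl3 : 0 < l 3) (hlu : ∀ k ≤ 3, l k ≤ u k) :
    (∀ p : ℝ[X], p.natDegree = 3 → (∀ k ≤ 3, l k ≤ p.coeff k ∧ p.coeff k ≤ u k) → ∀ z ∈ (p.map (algebraMap ℝ ℂ)).roots, z.re < 0)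
      ↔ 0 < l 0 ∧ ∀ z ∈ ((C (u 3) * X ^ 3 + C (l 2) * X ^ 2 + C (l 1) * X + C (u 0) : ℝ[X]).map (algebraMap ℝ ℂ)).roots, z.re < 0 := by
  have hu3 : 0 < u 3 := hl3.trans_le (hlu 3 le_rfl)
  have hqdeg : (C (u 3) * X ^ 3 + C (l 2) * X ^ 2 + C (l 1) * X + C (u 0) : ℝ[X]).natDegree = 3 := natDegree_cubic hu3.ne'
  have hq3 : (C (u 3) * X ^ 3 + C (l 2) * X ^ 2 + C (l 1) * X + C (u 0) : ℝ[X]).coeff 3 = u 3 := by simp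
  have hq0 : (C (u 3) * X ^ 3 + C (l 2) * X ^ 2 + C (l 1) * X + C (u 0) : ℝ[X]).coeff 0 = u 0 := by simp
  have hq1 : (C (u 3) * X ^ 3 + C (l 2) * X ^ 2 + C (l 1) * X + C (u 0) : ℝ[X]).coeff 1 = l 1 := by simp
  have hq2 : (C (u 3) * X ^ 3 + C (l 2) * X ^ 2 + C (l 1) * X + C (u 0) : ℝ[X]).coeff 2 = l 2 := by simp
  rw [forall_re_neg_box_iff_of_natDegree_three hl3 hlu, forall_re_neg_iff_of_natDegree_three hqdeg (by rw [hq3]; exact hu3), hq0, hq1, hq2, hq3]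
  constructor
  · rintro ⟨h0, h2, h12⟩
    exact ⟨h0, h2, by linarith, h0.trans_le (hlu 0 (by norm_num))⟩
  · rintro ⟨h0, h2, h12, -⟩
    exact ⟨h0, h2, by linarith⟩

end Summit.Ventures.HSemireg.Wedge.HankelOuter
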